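import Summits.CriticalPhenomena.PercolationContinuityZ3.Theorems.PercNearOneGluingNoHeavyLowerTailSahiGridPatternCostless

/-!
# `NoHeavyLowerTail` (crux stmt-CriticalPhenomena-4575), Sahi programme: **THE W-FORM OF THE UPPER-STEP SLACK, EVERY DIMENSION —
# `c₂ − 2c₃ − c(A,B′,C′) = Θ_B + Θ_C + g_A + g_B + g_C − 2·M(W_A)` with the SINGLE negative term `W_A = A ∩ (B′∩C′) ∖ (B∩C)`;
# hence `c₂ ≥ 2c₃ + c(A,B′,C′)` on the face `W_A = ∅`, which contains the empty-bottom, costless-slots and meet-bottom faces**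

Support file (seat `prim-ineq-gen-4`, generation 14; `--supports stmt-CriticalPhenomena-4575`).  Pure proofs, no definitions, no `sorry`, standard axioms.
Vocabulary and machinery of `…SahiGridPattern{Costless,KappaForm,UpperStepForm,TwoLayerTop,TwoSetsTop,TopOnlyTop,Kleitman,Harris}`.

THE MATHEMATICS.  Upper-step triple `Au, Bu, Cu ⊆ [3]^{n+1}` (level-`1` slice = level-`2` slice), slices `A⁰ ⊆ A²`, `B⁰ ⊆ B²`, `C⁰ ⊆ C²`,
top triple `τ = (A²,B²,C²)`, "lowering of the `A`-slot" `(A⁰,B²,C²)`.  Subtracting the counting forms of `sStarD τ` and `sStarD(A⁰,B²,C²)` from the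
κ-form (`sStarD_upperStep_kappaForm`) gives, with NO hypothesis on the slices, the **W-FORM** (`sStarD_upperStep_wForm`):
  `sStarD Au Bu Cu − 4·sStarD τ − 2·sStarD(A⁰,B²,C²) = 2·(Θ_B + Θ_C + g_A + g_B + g_C) − 4·2^n·(D(A⁰B²C²) − D(A⁰B⁰C⁰))`,
  `Θ_B = [N(B²;A²,C²) − N(B⁰;A²,C²)] − [L(A²;B²,C²) − L(A²;B⁰,C²)]` (fibre-Kleitman gap, increment `B²∖B⁰` as free argument; `Θ_C` alike),
  `g_A = N(A²;B²,C²) − N(A²;B⁰,C⁰)`, `g_B = N(B²;A⁰,C²) − N(B²;A⁰,C⁰)`, `g_C = N(C²;A⁰,B²) − N(C²;A⁰,B⁰)` (monotone pair counts),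
and `D(A⁰B²C²) − D(A⁰B⁰C⁰) = #W_A`, `W_A := A⁰ ∩ (B²∩C²) ∖ (B⁰∩C⁰)` = the points of the `A`-BOTTOM lying in both other TOP slices but not in
both other BOTTOM slices — the ONLY negative term.  In cube language: `c₂ − 2c₃ − c(A,B′,C′) = Θ_B + Θ_C + g_A + g_B + g_C − 2·M(W_A)`, so
COMB-M⁺ (`c₂ ≥ c₃`) is EQUIVALENT to `2·M(W_A) ≤ c(τ) + c(A,B′,C′) + Θ_B + Θ_C + g_A + g_B + g_C` (one such form per slot).
CONSEQUENCES (every `n`, up-sets):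
* `four_mul_sStarD_top_add_two_mul_le_of_upperStep_wface`: on the face **`W_A = ∅`** (`A⁰∩B²∩C² ⊆ B⁰∩C⁰`: the `A`-bottom meets the top meet
  only inside the bottom meet) **`4·sStarD τ + 2·sStarD(A⁰,B²,C²) ≤ sStarD Au Bu Cu`**, i.e. `c₂ ≥ 2c₃ + c(A,B′,C′)`, SHARP.  This single face
  contains the EMPTY-BOTTOM face (`A⁰ = ∅`, `…EmptyBottom`), the COSTLESS-SLOTS face (`A²B²C² ⊆ B⁰∩C⁰`, `…Costless`) and the new
  MEET-BOTTOM face (`A⁰ ⊆ B⁰ ∩ C⁰`, `four_mul_sStarD_top_add_two_mul_le_of_upperStep_meetBottom`: "one bottom inside the other two bottoms",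
  e.g. all three bottoms equal); `two_mul_sStarD_top_le_of_upperStep_wface` is COMB-M⁺ there given the two `n`-dimensional functionals `≥ 0`.
* `sStarD_upperStep_wForm_le`: in general `4·sStarD τ + 2·sStarD(A⁰,B²,C²) ≤ sStarD Au Bu Cu + 4·2^n·#W_A` — the deficit from the
  factor-2 bound is at most `4·2^n` per point of `W_A`.
Census (seat folder `work/comb/faceABC2.c`, `gen_check.py`): identity and sharpness verified on 6.6·10⁶ (m = 4, exhaustive nested pairs with
`∅ ≠ A ⊆ B∩C`) + 3.1·10⁶ (m = 5) cells, equality `c₂ = 2c₃ + c(A,B′,C′)` attained.  Memo: `run/shared/lean/prim/prim-ineq-gen-4/FINDING-W-FORM-g14.md`.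
HONEST LABEL: COMB-M⁺ in general (the case `W_A, W_B, W_C` all nonempty), `PatternPos d` (`d ≥ 4`), Sahi's `C₃` and Kahn's conjecture remain OPEN;
nothing here asserts them. [this work]
-/

namespace Summit.CriticalPhenomena.PercolationContinuityZ3.Theorems.SahiGridPattern

open Finset SahiGrid3
open scoped BigOperators

variable {n : ℕ}

/-- **THE W-FORM OF THE UPPER-STEP SLACK** (every `n`; an identity, no up-set hypothesis): for an upper-step triple `Au, Bu, Cu ⊆ [3]^{n+1}`,
`sStarD Au Bu Cu − 4·sStarD τ − 2·sStarD(A⁰,B²,C²) = 2·(Θ_B + Θ_C + g_A + g_B + g_C) − 4·2^n·(D(A⁰B²C²) − D(A⁰B⁰C⁰))`. [this work] -/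
theorem sStarD_upperStep_wForm (Au Bu Cu : Finset (Pd (n + 1)))
    (hAu : ∀ q : Pd n, ind Au (Fin.snoc q 1 : Pd (n + 1)) = ind Au (Fin.snoc q 2 : Pd (n + 1)))
    (hBu : ∀ q : Pd n, ind Bu (Fin.snoc q 1 : Pd (n + 1)) = ind Bu (Fin.snoc q 2 : Pd (n + 1)))
    (hCu : ∀ q : Pd n, ind Cu (Fin.snoc q 1 : Pd (n + 1)) = ind Cu (Fin.snoc q 2 : Pd (n + 1))) :
    sStarD Au Bu Cu - 4 * sStarD (univ.filter fun q : Pd n => (Fin.snoc q 2 : Pd (n + 1)) ∈ Au) (univ.filter fun q : Pd n => (Fin.snoc q 2 : Pd (n + 1)) ∈ Bu) (univ.filter fun q : Pd n => (Fin.snoc q 2 : Pd (n + 1)) ∈ Cu) - 2 * sStarD (univ.filter fun q : Pd n => (Fin.snoc q 0 : Pd (n + 1)) ∈ Au) (univ.filter fun q : Pd n => (Fin.snoc q 2 : Pd (n + 1)) ∈ Bu) (univ.filter fun q : Pd n => (Fin.snoc q 2 : Pd (n + 1)) ∈ Cu) =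
      2 * (((∑ p, ∑ q, ind (univ.filter fun q : Pd n => (Fin.snoc q 2 : Pd (n + 1)) ∈ Bu) p * ind (univ.filter fun q : Pd n => (Fin.snoc q 2 : Pd (n + 1)) ∈ Au) q * ind (univ.filter fun q : Pd n => (Fin.snoc q 2 : Pd (n + 1)) ∈ Cu) q * (if TotDist p q = true then (1:ℤ) else 0)) - (∑ p, ∑ q, ind (univ.filter fun q : Pd n => (Fin.snoc q 0 : Pd (n + 1)) ∈ Bu) p * ind (univ.filter fun q : Pd n => (Fin.snoc q 2 : Pd (n + 1)) ∈ Au) q * ind (univ.filter fun q : Pd n => (Fin.snoc q 2 : Pd (n + 1)) ∈ Cu) q * (if TotDist p q = true then (1:ℤ) else 0)) - (∑ q, ∑ r, ind (univ.filter fun q : Pd n => (Fin.snoc q 2 : Pd (n + 1)) ∈ Bu) q * ind (univ.filter fun q : Pd n => (Fin.snoc q 2 : Pd (n + 1)) ∈ Cu) r * ind (univ.filter fun q : Pd n => (Fin.snoc q 2 : Pd (n + 1)) ∈ Au) (thirdPt q r) * (if TotDist q r = true then (1:ℤ) else 0)) + (∑ q, ∑ r, ind (univ.filter fun q : Pd n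 => (Fin.snoc q 0 : Pd (n + 1)) ∈ Bu) q * ind (univ.filter fun q : Pd n => (Fin.snoc q 2 : Pd (n + 1)) ∈ Cu) r * ind (univ.filter fun q : Pd n => (Fin.snoc q 2 : Pd (n + 1)) ∈ Au) (thirdPt q r) * (if TotDist q r = true then (1:ℤ) else 0)))
        + ((∑ p, ∑ q, ind (univ.filter fun q : Pd n => (Fin.snoc q 2 : Pd (n + 1)) ∈ Cu) p * ind (univ.filter fun q : Pd n => (Fin.snoc q 2 : Pd (n + 1)) ∈ Au) q * ind (univ.filter fun q : Pd n => (Fin.snoc q 2 : Pd (n + 1)) ∈ Bu) q * (if TotDist p q = true then (1:ℤ) else 0)) - (∑ p, ∑ q, ind (univ.filter fun q : Pd n => (Fin.snoc q 0 : Pd (n + 1)) ∈ Cu) p * ind (univ.filter fun q : Pd n => (Fin.snoc q 2 : Pd (n + 1)) ∈ Au) q * ind (univ.filter fun q : Pd n => (Fin.snoc q 2 : Pd (n + 1)) ∈ Bu) q * (if TotDist p q = true then (1:ℤ) else 0)) - (∑ q, ∑ r, ind (univ.filter fun q : Pd n => (Fin.snoc q 2 : Pd (n + 1)) ∈ Bu)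 q * ind (univ.filter fun q : Pd n => (Fin.snoc q 2 : Pd (n + 1)) ∈ Cu) r * ind (univ.filter fun q : Pd n => (Fin.snoc q 2 : Pd (n + 1)) ∈ Au) (thirdPt q r) * (if TotDist q r = true then (1:ℤ) else 0)) + (∑ q, ∑ r, ind (univ.filter fun q : Pd n => (Fin.snoc q 2 : Pd (n + 1)) ∈ Bu) q * ind (univ.filter fun q : Pd n => (Fin.snoc q 0 : Pd (n + 1)) ∈ Cu) r * ind (univ.filter fun q : Pd n => (Fin.snoc q 2 : Pd (n + 1)) ∈ Au) (thirdPt q r) * (if TotDist q r = true then (1:ℤ) else 0)))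
        + ((∑ p, ∑ q, ind (univ.filter fun q : Pd n => (Fin.snoc q 2 : Pd (n + 1)) ∈ Au) p * ind (univ.filter fun q : Pd n => (Fin.snoc q 2 : Pd (n + 1)) ∈ Bu) q * ind (univ.filter fun q : Pd n => (Fin.snoc q 2 : Pd (n + 1)) ∈ Cu) q * (if TotDist p q = true then (1:ℤ) else 0)) - (∑ p, ∑ q, ind (univ.filter fun q : Pd n => (Fin.snoc q 2 : Pd (n + 1)) ∈ Au) p * ind (univ.filter fun q : Pd n => (Fin.snoc q 0 : Pd (n + 1)) ∈ Bu) q * ind (univ.filter fun q : Pd n => (Fin.snoc q 0 : Pd (n + 1)) ∈ Cu) q * (if TotDist p q = true then (1:ℤ) else 0)))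
        + ((∑ p, ∑ q, ind (univ.filter fun q : Pd n => (Fin.snoc q 2 : Pd (n + 1)) ∈ Bu) p * ind (univ.filter fun q : Pd n => (Fin.snoc q 0 : Pd (n + 1)) ∈ Au) q * ind (univ.filter fun q : Pd n => (Fin.snoc q 2 : Pd (n + 1)) ∈ Cu) q * (if TotDist p q = true then (1:ℤ) else 0)) - (∑ p, ∑ q, ind (univ.filter fun q : Pd n => (Fin.snoc q 2 : Pd (n + 1)) ∈ Bu) p * ind (univ.filter fun q : Pd n => (Fin.snoc q 0 : Pd (n + 1)) ∈ Au) q * ind (univ.filter fun q : Pd n => (Fin.snoc q 0 : Pd (n + 1)) ∈ Cu) q * (if TotDist p q = true then (1:ℤ) else 0)))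
        + ((∑ p, ∑ q, ind (univ.filter fun q : Pd n => (Fin.snoc q 2 : Pd (n + 1)) ∈ Cu) p * ind (univ.filter fun q : Pd n => (Fin.snoc q 0 : Pd (n + 1)) ∈ Au) q * ind (univ.filter fun q : Pd n => (Fin.snoc q 2 : Pd (n + 1)) ∈ Bu) q * (if TotDist p q = true then (1:ℤ) else 0)) - (∑ p, ∑ q, ind (univ.filter fun q : Pd n => (Fin.snoc q 2 : Pd (n + 1)) ∈ Cu) p * ind (univ.filter fun q : Pd n => (Fin.snoc q 0 : Pd (n + 1)) ∈ Au) q * ind (univ.filter fun q : Pd n => (Fin.snoc q 0 : Pd (n + 1)) ∈ Bu) q * (if TotDist p q = true then (1:ℤ) else 0))))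
      - 4 * 2 ^ n * ((∑ p, ind (univ.filter fun q : Pd n => (Fin.snoc q 0 : Pd (n + 1)) ∈ Au) p * ind (univ.filter fun q : Pd n => (Fin.snoc q 2 : Pd (n + 1)) ∈ Bu) p * ind (univ.filter fun q : Pd n => (Fin.snoc q 2 : Pd (n + 1)) ∈ Cu) p) - (∑ p, ind (univ.filter fun q : Pd n => (Fin.snoc q 0 : Pd (n + 1)) ∈ Au) p * ind (univ.filter fun q : Pd n => (Fin.snoc q 0 : Pd (n + 1)) ∈ Bu) p * ind (univ.filter fun q : Pd n => (Fin.snoc q 0 : Pd (n + 1)) ∈ Cu) p)) := by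
  have eK := sStarD_upperStep_kappaForm Au Bu Cu hAu hBu hCu
  have eT := sStarD_counting (univ.filter fun q : Pd n => (Fin.snoc q 2 : Pd (n + 1)) ∈ Au) (univ.filter fun q : Pd n => (Fin.snoc q 2 : Pd (n + 1)) ∈ Bu) (univ.filter fun q : Pd n => (Fin.snoc q 2 : Pd (n + 1)) ∈ Cu)
  have eL := sStarD_counting (univ.filter fun q : Pd n => (Fin.snoc q 0 : Pd (n + 1)) ∈ Au) (univ.filter fun q : Pd n => (Fin.snoc q 2 : Pd (n + 1)) ∈ Bu) (univ.filter fun q : Pd n => (Fin.snoc q 2 : Pd (n + 1)) ∈ Cu)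
  linarith [eK, eT, eL]

/-- **THE GENERAL W-BOUND** (every `n`): for an upper-step triple of up-sets, `4·sStarD τ + 2·sStarD(A⁰,B²,C²) ≤ sStarD Au Bu Cu + 4·2^n·#W_A`
with `#W_A = D(A⁰B²C²) − D(A⁰B⁰C⁰)` the number of points of the `A`-bottom in both other top slices but not in both other bottom slices:
the five terms `Θ_B, Θ_C, g_A, g_B, g_C` of the W-form are nonnegative (fibre Kleitman with the increments as free argument; slice monotonicity). [this work] -/
theorem sStarD_upperStep_wForm_le (Au Bu Cu : Finset (Pd (n + 1)))
    (hA : IsUpperSet (Au : Set (Pd (n + 1)))) (hB : IsUpperSet (Bu : Set (Pd (n + 1)))) (hC : IsUpperSet (Cu : Set (Pd (n + 1))))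
    (hAu : ∀ q : Pd n, ind Au (Fin.snoc q 1 : Pd (n + 1)) = ind Au (Fin.snoc q 2 : Pd (n + 1)))
    (hBu : ∀ q : Pd n, ind Bu (Fin.snoc q 1 : Pd (n + 1)) = ind Bu (Fin.snoc q 2 : Pd (n + 1)))
    (hCu : ∀ q : Pd n, ind Cu (Fin.snoc q 1 : Pd (n + 1)) = ind Cu (Fin.snoc q 2 : Pd (n + 1))) :
    4 * sStarD (univ.filter fun q : Pd n => (Fin.snoc q 2 : Pd (n + 1)) ∈ Au) (univ.filter fun q : Pd n => (Fin.snoc q 2 : Pd (n + 1)) ∈ Bu) (univ.filter fun q : Pd n => (Fin.snoc q 2 : Pd (n + 1)) ∈ Cu) + 2 * sStarD (univ.filter fun q : Pd n => (Fin.snoc q 0 : Pd (n + 1)) ∈ Au) (univ.filter fun q : Pd n => (Fin.snoc q 2 : Pd (n + 1)) ∈ Bu) (univ.filter fun q : Pd n => (Fin.snoc q 2 : Pd (n + 1)) ∈ Cu) ≤ sStarD Au Bu Cu + 4 * 2 ^ n * ((∑ p, ind (univ.filter fun q : Pd n => (Fin.snoc q 0 : Pd (n + 1)) ∈ Au) p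 * ind (univ.filter fun q : Pd n => (Fin.snoc q 2 : Pd (n + 1)) ∈ Bu) p * ind (univ.filter fun q : Pd n => (Fin.snoc q 2 : Pd (n + 1)) ∈ Cu) p) - (∑ p, ind (univ.filter fun q : Pd n => (Fin.snoc q 0 : Pd (n + 1)) ∈ Au) p * ind (univ.filter fun q : Pd n => (Fin.snoc q 0 : Pd (n + 1)) ∈ Bu) p * ind (univ.filter fun q : Pd n => (Fin.snoc q 0 : Pd (n + 1)) ∈ Cu) p)) := by
  have eI := sStarD_upperStep_wForm Au Bu Cu hAu hBu hCu
  have hA2up : IsUpperSet (((univ.filter fun q : Pd n => (Fin.snoc q 2 : Pd (n + 1)) ∈ Au) : Finset (Pd n)) : Set (Pd n)) := isUpperSet_filter_snoc hA 2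
  have hB2up : IsUpperSet (((univ.filter fun q : Pd n => (Fin.snoc q 2 : Pd (n + 1)) ∈ Bu) : Finset (Pd n)) : Set (Pd n)) := isUpperSet_filter_snoc hB 2
  have hC2up : IsUpperSet (((univ.filter fun q : Pd n => (Fin.snoc q 2 : Pd (n + 1)) ∈ Cu) : Finset (Pd n)) : Set (Pd n)) := isUpperSet_filter_snoc hC 2
  have sB : (univ.filter fun q : Pd n => (Fin.snoc q 0 : Pd (n + 1)) ∈ Bu) ⊆ (univ.filter fun q : Pd n => (Fin.snoc q 2 : Pd (n + 1)) ∈ Bu) := by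
    intro q hq
    rw [mem_filter] at hq ⊢
    exact ⟨mem_univ _, hB (snoc_le_snoc_of_le q (by decide : (0:Fin 3) ≤ 2)) hq.2⟩
  have sC : (univ.filter fun q : Pd n => (Fin.snoc q 0 : Pd (n + 1)) ∈ Cu) ⊆ (univ.filter fun q : Pd n => (Fin.snoc q 2 : Pd (n + 1)) ∈ Cu) := by
    intro q hq
    rw [mem_filter] at hq ⊢
    exact ⟨mem_univ _, hC (snoc_le_snoc_of_le q (by decide : (0:Fin 3) ≤ 2)) hq.2⟩
  have nB : ∀ p, ind (univ.filter fun q : Pd n => (Fin.snoc q 0 : Pd (n + 1)) ∈ Bu) p ≤ ind (univ.filter fun q : Pd n => (Fin.snoc q 2 : Pd (n + 1)) ∈ Bu) p := fun p => by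
    rw [ind_filter_snoc, ind_filter_snoc]; exact ind_snoc_mono hB p (by decide)
  have nC : ∀ p, ind (univ.filter fun q : Pd n => (Fin.snoc q 0 : Pd (n + 1)) ∈ Cu) p ≤ ind (univ.filter fun q : Pd n => (Fin.snoc q 2 : Pd (n + 1)) ∈ Cu) p := fun p => by
    rw [ind_filter_snoc, ind_filter_snoc]; exact ind_snoc_mono hC p (by decide)
  -- Θ_B ≥ 0
  have TB : 0 ≤ ((∑ p, ∑ q, ind (univ.filter fun q : Pd n => (Fin.snoc q 2 : Pd (n + 1)) ∈ Bu) p * ind (univ.filter fun q : Pd n => (Fin.snoc q 2 : Pd (n + 1)) ∈ Au) q * ind (univ.filter fun q : Pd n => (Fin.snoc q 2 : Pd (n + 1)) ∈ Cu) q * (if TotDist p q = true then (1:ℤ) else 0)) - (∑ p, ∑ q, ind (univ.filter fun q : Pd n => (Fin.snoc q 0 : Pd (n + 1)) ∈ Bu) p * ind (univ.filter fun q : Pd n => (Fin.snoc q 2 : Pd (n + 1)) ∈ Au) q * ind (univ.filter fun q : Pd n => (Fin.snoc q 2 : Pd (n + 1)) ∈ Cu) q * (if TotDist p q = true then (1:ℤ)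 else 0)) - (∑ q, ∑ r, ind (univ.filter fun q : Pd n => (Fin.snoc q 2 : Pd (n + 1)) ∈ Bu) q * ind (univ.filter fun q : Pd n => (Fin.snoc q 2 : Pd (n + 1)) ∈ Cu) r * ind (univ.filter fun q : Pd n => (Fin.snoc q 2 : Pd (n + 1)) ∈ Au) (thirdPt q r) * (if TotDist q r = true then (1:ℤ) else 0)) + (∑ q, ∑ r, ind (univ.filter fun q : Pd n => (Fin.snoc q 0 : Pd (n + 1)) ∈ Bu) q * ind (univ.filter fun q : Pd n => (Fin.snoc q 2 : Pd (n + 1)) ∈ Cu) r * ind (univ.filter fun q : Pd n => (Fin.snoc q 2 : Pd (n + 1)) ∈ Au) (thirdPt q r) * (if TotDist q r = true then (1:ℤ) else 0))) := by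
    have K0 := sum_ind_lat_le_td ((univ.filter fun q : Pd n => (Fin.snoc q 2 : Pd (n + 1)) ∈ Bu) \ (univ.filter fun q : Pd n => (Fin.snoc q 0 : Pd (n + 1)) ∈ Bu)) hC2up hA2up
    have e1 : (∑ p, ∑ q, ind ((univ.filter fun q : Pd n => (Fin.snoc q 2 : Pd (n + 1)) ∈ Bu) \ (univ.filter fun q : Pd n => (Fin.snoc q 0 : Pd (n + 1)) ∈ Bu)) p * ind (univ.filter fun q : Pd n => (Fin.snoc q 2 : Pd (n + 1)) ∈ Cu) q * ind (univ.filter fun q : Pd n => (Fin.snoc q 2 : Pd (n + 1)) ∈ Au) (thirdPt p q) * (if TotDist p q = true then (1:ℤ) else 0)) =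
        (∑ q, ∑ r, ind (univ.filter fun q : Pd n => (Fin.snoc q 2 : Pd (n + 1)) ∈ Bu) q * ind (univ.filter fun q : Pd n => (Fin.snoc q 2 : Pd (n + 1)) ∈ Cu) r * ind (univ.filter fun q : Pd n => (Fin.snoc q 2 : Pd (n + 1)) ∈ Au) (thirdPt q r) * (if TotDist q r = true then (1:ℤ) else 0)) - (∑ q, ∑ r, ind (univ.filter fun q : Pd n => (Fin.snoc q 0 : Pd (n + 1)) ∈ Bu) q * ind (univ.filter fun q : Pd n => (Fin.snoc q 2 : Pd (n + 1)) ∈ Cu) r * ind (univ.filter fun q : Pd n => (Fin.snoc q 2 : Pd (n + 1)) ∈ Au) (thirdPt q r) * (if TotDist q r = true then (1:ℤ) else 0)) := by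
      rw [← Finset.sum_sub_distrib]
      refine Finset.sum_congr rfl fun p _ => ?_
      rw [← Finset.sum_sub_distrib]
      refine Finset.sum_congr rfl fun q _ => ?_
      rw [ind_sdiff_of_subset sB]; ring
    have e2 : (∑ p, ∑ q, ind ((univ.filter fun q : Pd n => (Fin.snoc q 2 : Pd (n + 1)) ∈ Bu) \ (univ.filter fun q : Pd n => (Fin.snoc q 0 : Pd (n + 1)) ∈ Bu)) p * ind (univ.filter fun q : Pd n => (Fin.snoc q 2 : Pd (n + 1)) ∈ Cu) q * ind (univ.filter fun q : Pd n => (Fin.snoc q 2 : Pd (n + 1)) ∈ Au) q * (if TotDist p q = true then (1:ℤ) else 0)) =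
        (∑ p, ∑ q, ind (univ.filter fun q : Pd n => (Fin.snoc q 2 : Pd (n + 1)) ∈ Bu) p * ind (univ.filter fun q : Pd n => (Fin.snoc q 2 : Pd (n + 1)) ∈ Au) q * ind (univ.filter fun q : Pd n => (Fin.snoc q 2 : Pd (n + 1)) ∈ Cu) q * (if TotDist p q = true then (1:ℤ) else 0)) - (∑ p, ∑ q, ind (univ.filter fun q : Pd n => (Fin.snoc q 0 : Pd (n + 1)) ∈ Bu) p * ind (univ.filter fun q : Pd n => (Fin.snoc q 2 : Pd (n + 1)) ∈ Au) q * ind (univ.filter fun q : Pd n => (Fin.snoc q 2 : Pd (n + 1)) ∈ Cu) q * (if TotDist p q = true then (1:ℤ) else 0)) := by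
      rw [← Finset.sum_sub_distrib]
      refine Finset.sum_congr rfl fun p _ => ?_
      rw [← Finset.sum_sub_distrib]
      refine Finset.sum_congr rfl fun q _ => ?_
      rw [ind_sdiff_of_subset sB]; ring
    rw [e1, e2] at K0
    linarith
  -- Θ_C ≥ 0
  have TC : 0 ≤ ((∑ p, ∑ q, ind (univ.filter fun q : Pd n => (Fin.snoc q 2 : Pd (n + 1)) ∈ Cu) p * ind (univ.filter fun q : Pd n => (Fin.snoc q 2 : Pd (n + 1)) ∈ Au) q * ind (univ.filter fun q : Pd n => (Fin.snoc q 2 : Pd (n + 1)) ∈ Bu) q * (if TotDist p q = true then (1:ℤ) else 0)) - (∑ p, ∑ q, ind (univ.filter fun q : Pd n => (Fin.snoc q 0 : Pd (n + 1)) ∈ Cu) p * ind (univ.filter fun q : Pd n => (Fin.snoc q 2 : Pd (n + 1)) ∈ Au) q * ind (univ.filter fun q : Pd n => (Fin.snoc q 2 : Pd (n + 1)) ∈ Bu) q * (if TotDist p q = true then (1:ℤ) else 0)) - (∑ q, ∑ r, ind (univ.filter fun q : Pd n => (Fin.snoc q 2 : Pd (n + 1)) ∈ Bu) q * ind (univ.filter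 fun q : Pd n => (Fin.snoc q 2 : Pd (n + 1)) ∈ Cu) r * ind (univ.filter fun q : Pd n => (Fin.snoc q 2 : Pd (n + 1)) ∈ Au) (thirdPt q r) * (if TotDist q r = true then (1:ℤ) else 0)) + (∑ q, ∑ r, ind (univ.filter fun q : Pd n => (Fin.snoc q 2 : Pd (n + 1)) ∈ Bu) q * ind (univ.filter fun q : Pd n => (Fin.snoc q 0 : Pd (n + 1)) ∈ Cu) r * ind (univ.filter fun q : Pd n => (Fin.snoc q 2 : Pd (n + 1)) ∈ Au) (thirdPt q r) * (if TotDist q r = true then (1:ℤ) else 0))) := by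
    have K0 := sum_ind_lat_le_td ((univ.filter fun q : Pd n => (Fin.snoc q 2 : Pd (n + 1)) ∈ Cu) \ (univ.filter fun q : Pd n => (Fin.snoc q 0 : Pd (n + 1)) ∈ Cu)) hB2up hA2up
    have e1 : (∑ p, ∑ q, ind ((univ.filter fun q : Pd n => (Fin.snoc q 2 : Pd (n + 1)) ∈ Cu) \ (univ.filter fun q : Pd n => (Fin.snoc q 0 : Pd (n + 1)) ∈ Cu)) p * ind (univ.filter fun q : Pd n => (Fin.snoc q 2 : Pd (n + 1)) ∈ Bu) q * ind (univ.filter fun q : Pd n => (Fin.snoc q 2 : Pd (n + 1)) ∈ Au) (thirdPt p q) * (if TotDist p q = true then (1:ℤ) else 0)) =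
        (∑ q, ∑ r, ind (univ.filter fun q : Pd n => (Fin.snoc q 2 : Pd (n + 1)) ∈ Bu) q * ind (univ.filter fun q : Pd n => (Fin.snoc q 2 : Pd (n + 1)) ∈ Cu) r * ind (univ.filter fun q : Pd n => (Fin.snoc q 2 : Pd (n + 1)) ∈ Au) (thirdPt q r) * (if TotDist q r = true then (1:ℤ) else 0)) - (∑ q, ∑ r, ind (univ.filter fun q : Pd n => (Fin.snoc q 2 : Pd (n + 1)) ∈ Bu) q * ind (univ.filter fun q : Pd n => (Fin.snoc q 0 : Pd (n + 1)) ∈ Cu) r * ind (univ.filter fun q : Pd n => (Fin.snoc q 2 : Pd (n + 1)) ∈ Au) (thirdPt q r) * (if TotDist q r = true then (1:ℤ) else 0)) := by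
      rw [Finset.sum_comm, ← Finset.sum_sub_distrib]
      refine Finset.sum_congr rfl fun q _ => ?_
      rw [← Finset.sum_sub_distrib]
      refine Finset.sum_congr rfl fun r _ => ?_
      rw [ind_sdiff_of_subset sC, thirdPt_comm r q, totDist_symm r q]; ring
    have e2 : (∑ p, ∑ q, ind ((univ.filter fun q : Pd n => (Fin.snoc q 2 : Pd (n + 1)) ∈ Cu) \ (univ.filter fun q : Pd n => (Fin.snoc q 0 : Pd (n + 1)) ∈ Cu)) p * ind (univ.filter fun q : Pd n => (Fin.snoc q 2 : Pd (n + 1)) ∈ Bu) q * ind (univ.filter fun q : Pd n => (Fin.snoc q 2 : Pd (n + 1)) ∈ Au) q * (if TotDist p q = true then (1:ℤ) else 0)) =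
        (∑ p, ∑ q, ind (univ.filter fun q : Pd n => (Fin.snoc q 2 : Pd (n + 1)) ∈ Cu) p * ind (univ.filter fun q : Pd n => (Fin.snoc q 2 : Pd (n + 1)) ∈ Au) q * ind (univ.filter fun q : Pd n => (Fin.snoc q 2 : Pd (n + 1)) ∈ Bu) q * (if TotDist p q = true then (1:ℤ) else 0)) - (∑ p, ∑ q, ind (univ.filter fun q : Pd n => (Fin.snoc q 0 : Pd (n + 1)) ∈ Cu) p * ind (univ.filter fun q : Pd n => (Fin.snoc q 2 : Pd (n + 1)) ∈ Au) q * ind (univ.filter fun q : Pd n => (Fin.snoc q 2 : Pd (n + 1)) ∈ Bu) q * (if TotDist p q = true then (1:ℤ) else 0)) := by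
      rw [← Finset.sum_sub_distrib]
      refine Finset.sum_congr rfl fun p _ => ?_
      rw [← Finset.sum_sub_distrib]
      refine Finset.sum_congr rfl fun q _ => ?_
      rw [ind_sdiff_of_subset sC]; ring
    rw [e1, e2] at K0
    linarith
  have GA : (∑ p, ∑ q, ind (univ.filter fun q : Pd n => (Fin.snoc q 2 : Pd (n + 1)) ∈ Au) p * ind (univ.filter fun q : Pd n => (Fin.snoc q 0 : Pd (n + 1)) ∈ Bu) q * ind (univ.filter fun q : Pd n => (Fin.snoc q 0 : Pd (n + 1)) ∈ Cu) q * (if TotDist p q = true then (1:ℤ) else 0)) ≤ (∑ p, ∑ q, ind (univ.filter fun q : Pd n => (Fin.snoc q 2 : Pd (n + 1)) ∈ Au) p * ind (univ.filter fun q : Pd n => (Fin.snoc q 2 : Pd (n + 1)) ∈ Bu) q * ind (univ.filter fun q : Pd n => (Fin.snoc q 2 : Pd (n + 1)) ∈ Cu) q * (if TotDist p q = true then (1:ℤ) else 0)) :=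
    Finset.sum_le_sum fun p _ => Finset.sum_le_sum fun q _ =>
      mul4_mono_mid (ind_nonneg' _ _) (ind_nonneg' _ _) (ind_nonneg' _ _) (by split_ifs <;> norm_num) (nB q) (nC q)
  have GB : (∑ p, ∑ q, ind (univ.filter fun q : Pd n => (Fin.snoc q 2 : Pd (n + 1)) ∈ Bu) p * ind (univ.filter fun q : Pd n => (Fin.snoc q 0 : Pd (n + 1)) ∈ Au) q * ind (univ.filter fun q : Pd n => (Fin.snoc q 0 : Pd (n + 1)) ∈ Cu) q * (if TotDist p q = true then (1:ℤ) else 0)) ≤ (∑ p, ∑ q, ind (univ.filter fun q : Pd n => (Fin.snoc q 2 : Pd (n + 1)) ∈ Bu) p * ind (univ.filter fun q : Pd n => (Fin.snoc q 0 : Pd (n + 1)) ∈ Au) q * ind (univ.filter fun q : Pd n => (Fin.snoc q 2 : Pd (n + 1)) ∈ Cu) q * (if TotDist p q = true then (1:ℤ) else 0)) :=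
    Finset.sum_le_sum fun p _ => Finset.sum_le_sum fun q _ =>
      mul4_mono_mid (ind_nonneg' _ _) (ind_nonneg' _ _) (ind_nonneg' _ _) (by split_ifs <;> norm_num) (le_refl _) (nC q)
  have GC : (∑ p, ∑ q, ind (univ.filter fun q : Pd n => (Fin.snoc q 2 : Pd (n + 1)) ∈ Cu) p * ind (univ.filter fun q : Pd n => (Fin.snoc q 0 : Pd (n + 1)) ∈ Au) q * ind (univ.filter fun q : Pd n => (Fin.snoc q 0 : Pd (n + 1)) ∈ Bu) q * (if TotDist p q = true then (1:ℤ) else 0)) ≤ (∑ p, ∑ q, ind (univ.filter fun q : Pd n => (Fin.snoc q 2 : Pd (n + 1)) ∈ Cu) p * ind (univ.filter fun q : Pd n => (Fin.snoc q 0 : Pd (n + 1)) ∈ Au) q * ind (univ.filter fun q : Pd n => (Fin.snoc q 2 : Pd (n + 1)) ∈ Bu) q * (if TotDist p q = true then (1:ℤ) else 0)) :=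
    Finset.sum_le_sum fun p _ => Finset.sum_le_sum fun q _ =>
      mul4_mono_mid (ind_nonneg' _ _) (ind_nonneg' _ _) (ind_nonneg' _ _) (by split_ifs <;> norm_num) (le_refl _) (nB q)
  linarith [eI, TB, TC, GA, GB, GC]

/-- **`c₂ ≥ 2c₃ + c(A,B′,C′)` ON THE FACE `W_A = ∅`** (every `n`; SHARP): for an upper-step triple of up-sets `Au, Bu, Cu ⊆ [3]^{n+1}` such that every
point of the bottom slice `A⁰` lying in both top slices `B², C²` lies in both bottom slices `B⁰, C⁰`, `4·sStarD τ + 2·sStarD(A⁰,B²,C²) ≤ sStarD Au Bu Cu`.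
Contains the empty-bottom face (`A⁰ = ∅`), the costless-slots face (`A²B²C² ⊆ B⁰ ∩ C⁰`) and the meet-bottom face (`A⁰ ⊆ B⁰∩C⁰`). [this work] -/
theorem four_mul_sStarD_top_add_two_mul_le_of_upperStep_wface (Au Bu Cu : Finset (Pd (n + 1)))
    (hA : IsUpperSet (Au : Set (Pd (n + 1)))) (hB : IsUpperSet (Bu : Set (Pd (n + 1)))) (hC : IsUpperSet (Cu : Set (Pd (n + 1))))
    (hAu : ∀ q : Pd n, ind Au (Fin.snoc q 1 : Pd (n + 1)) = ind Au (Fin.snoc q 2 : Pd (n + 1)))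
    (hBu : ∀ q : Pd n, ind Bu (Fin.snoc q 1 : Pd (n + 1)) = ind Bu (Fin.snoc q 2 : Pd (n + 1)))
    (hCu : ∀ q : Pd n, ind Cu (Fin.snoc q 1 : Pd (n + 1)) = ind Cu (Fin.snoc q 2 : Pd (n + 1)))
    (hWB : ∀ q : Pd n, (Fin.snoc q 0 : Pd (n + 1)) ∈ Au → (Fin.snoc q 2 : Pd (n + 1)) ∈ Bu → (Fin.snoc q 2 : Pd (n + 1)) ∈ Cu → (Fin.snoc q 0 : Pd (n + 1)) ∈ Bu)
    (hWC : ∀ q : Pd n, (Fin.snoc q 0 : Pd (n + 1)) ∈ Au → (Fin.snoc q 2 : Pd (n + 1)) ∈ Bu → (Fin.snoc q 2 : Pd (n + 1)) ∈ Cu → (Fin.snoc q 0 : Pd (n + 1)) ∈ Cu) :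
    4 * sStarD (univ.filter fun q : Pd n => (Fin.snoc q 2 : Pd (n + 1)) ∈ Au) (univ.filter fun q : Pd n => (Fin.snoc q 2 : Pd (n + 1)) ∈ Bu) (univ.filter fun q : Pd n => (Fin.snoc q 2 : Pd (n + 1)) ∈ Cu) + 2 * sStarD (univ.filter fun q : Pd n => (Fin.snoc q 0 : Pd (n + 1)) ∈ Au) (univ.filter fun q : Pd n => (Fin.snoc q 2 : Pd (n + 1)) ∈ Bu) (univ.filter fun q : Pd n => (Fin.snoc q 2 : Pd (n + 1)) ∈ Cu) ≤ sStarD Au Bu Cu := by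
  have h := sStarD_upperStep_wForm_le Au Bu Cu hA hB hC hAu hBu hCu
  have sB : ∀ q : Pd n, (Fin.snoc q 0 : Pd (n + 1)) ∈ Bu → (Fin.snoc q 2 : Pd (n + 1)) ∈ Bu :=
    fun q h => hB (snoc_le_snoc_of_le q (by decide : (0:Fin 3) ≤ 2)) h
  have sC : ∀ q : Pd n, (Fin.snoc q 0 : Pd (n + 1)) ∈ Cu → (Fin.snoc q 2 : Pd (n + 1)) ∈ Cu :=
    fun q h => hC (snoc_le_snoc_of_le q (by decide : (0:Fin 3) ≤ 2)) h
  have pW : ∀ q : Pd n, ind (univ.filter fun q : Pd n => (Fin.snoc q 0 : Pd (n + 1)) ∈ Au) q * ind (univ.filter fun q : Pd n => (Fin.snoc q 2 : Pd (n + 1)) ∈ Bu) q * ind (univ.filter fun q : Pd n => (Fin.snoc q 2 : Pd (n + 1)) ∈ Cu) q = ind (univ.filter fun q : Pd n => (Fin.snoc q 0 : Pd (n + 1)) ∈ Au) q * ind (univ.filter fun q : Pd n => (Fin.snoc q 0 : Pd (n + 1)) ∈ Bu) q * ind (univ.filter fun q : Pd n => (Fin.snoc q 0 : Pd (n + 1))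 ∈ Cu) q := by
    intro q; apply ind3_eq_of_iff; simp only [mem_filter, mem_univ, true_and]
    exact ⟨fun h => ⟨h.1, hWB q h.1 h.2.1 h.2.2, hWC q h.1 h.2.1 h.2.2⟩, fun h => ⟨h.1, sB q h.2.1, sC q h.2.2⟩⟩
  have dW : ((∑ p, ind (univ.filter fun q : Pd n => (Fin.snoc q 0 : Pd (n + 1)) ∈ Au) p * ind (univ.filter fun q : Pd n => (Fin.snoc q 2 : Pd (n + 1)) ∈ Bu) p * ind (univ.filter fun q : Pd n => (Fin.snoc q 2 : Pd (n + 1)) ∈ Cu) p) - (∑ p, ind (univ.filter fun q : Pd n => (Fin.snoc q 0 : Pd (n + 1)) ∈ Au) p * ind (univ.filter fun q : Pd n => (Fin.snoc q 0 : Pd (n + 1)) ∈ Bu) p * ind (univ.filter fun q : Pd n => (Fin.snoc q 0 : Pd (n + 1)) ∈ Cu) p)) = 0 := by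
    rw [sub_eq_zero]; exact Finset.sum_congr rfl fun q _ => pW q
  rw [dW, mul_zero, add_zero] at h
  exact h

/-- **COMB-M⁺ ON THE FACE `W_A = ∅`** (every `n`): top-slice dominance `2·sStarD τ ≤ sStarD υ` there, as soon as the two `n`-dimensional functionals
`sStarD τ` and `sStarD(A⁰,B²,C²)` are nonnegative (instances of `PatternPos n`; unconditional for `n ≤ 3`). [this work] -/
theorem two_mul_sStarD_top_le_of_upperStep_wface (Au Bu Cu : Finset (Pd (n + 1)))
    (hA : IsUpperSet (Au : Set (Pd (n + 1)))) (hB : IsUpperSet (Bu : Set (Pd (n + 1)))) (hC : IsUpperSet (Cu : Set (Pd (n + 1))))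
    (hAu : ∀ q : Pd n, ind Au (Fin.snoc q 1 : Pd (n + 1)) = ind Au (Fin.snoc q 2 : Pd (n + 1)))
    (hBu : ∀ q : Pd n, ind Bu (Fin.snoc q 1 : Pd (n + 1)) = ind Bu (Fin.snoc q 2 : Pd (n + 1)))
    (hCu : ∀ q : Pd n, ind Cu (Fin.snoc q 1 : Pd (n + 1)) = ind Cu (Fin.snoc q 2 : Pd (n + 1)))
    (hWB : ∀ q : Pd n, (Fin.snoc q 0 : Pd (n + 1)) ∈ Au → (Fin.snoc q 2 : Pd (n + 1)) ∈ Bu → (Fin.snoc q 2 : Pd (n + 1)) ∈ Cu → (Fin.snoc q 0 : Pd (n + 1)) ∈ Bu)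
    (hWC : ∀ q : Pd n, (Fin.snoc q 0 : Pd (n + 1)) ∈ Au → (Fin.snoc q 2 : Pd (n + 1)) ∈ Bu → (Fin.snoc q 2 : Pd (n + 1)) ∈ Cu → (Fin.snoc q 0 : Pd (n + 1)) ∈ Cu)
    (htop : 0 ≤ sStarD (univ.filter fun q : Pd n => (Fin.snoc q 2 : Pd (n + 1)) ∈ Au) (univ.filter fun q : Pd n => (Fin.snoc q 2 : Pd (n + 1)) ∈ Bu) (univ.filter fun q : Pd n => (Fin.snoc q 2 : Pd (n + 1)) ∈ Cu))
    (hlow : 0 ≤ sStarD (univ.filter fun q : Pd n => (Fin.snoc q 0 : Pd (n + 1)) ∈ Au) (univ.filter fun q : Pd n => (Fin.snoc q 2 : Pd (n + 1)) ∈ Bu) (univ.filter fun q : Pd n => (Fin.snoc q 2 : Pd (n + 1)) ∈ Cu)) :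
    2 * sStarD (univ.filter fun q : Pd n => (Fin.snoc q 2 : Pd (n + 1)) ∈ Au) (univ.filter fun q : Pd n => (Fin.snoc q 2 : Pd (n + 1)) ∈ Bu) (univ.filter fun q : Pd n => (Fin.snoc q 2 : Pd (n + 1)) ∈ Cu) ≤ sStarD Au Bu Cu := by
  have h := four_mul_sStarD_top_add_two_mul_le_of_upperStep_wface Au Bu Cu hA hB hC hAu hBu hCu hWB hWC
  linarith

/-- **THE MEET-BOTTOM FACE** (every `n`; SHARP): for an upper-step triple of up-sets whose `A`-bottom lies inside both other bottoms
(`A⁰ ⊆ B⁰ ∩ C⁰`; e.g. all three bottom slices equal), `4·sStarD τ + 2·sStarD(A⁰,B²,C²) ≤ sStarD Au Bu Cu`, i.e. `c₂ ≥ 2c₃ + c(A,B′,C′)`: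
here the slack is exactly the empty-bottom value plus `2·sStarD(A⁰,B²,C²)`. [this work] -/
theorem four_mul_sStarD_top_add_two_mul_le_of_upperStep_meetBottom (Au Bu Cu : Finset (Pd (n + 1)))
    (hA : IsUpperSet (Au : Set (Pd (n + 1)))) (hB : IsUpperSet (Bu : Set (Pd (n + 1)))) (hC : IsUpperSet (Cu : Set (Pd (n + 1))))
    (hAu : ∀ q : Pd n, ind Au (Fin.snoc q 1 : Pd (n + 1)) = ind Au (Fin.snoc q 2 : Pd (n + 1)))
    (hBu : ∀ q : Pd n, ind Bu (Fin.snoc q 1 : Pd (n + 1)) = ind Bu (Fin.snoc q 2 : Pd (n + 1)))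
    (hCu : ∀ q : Pd n, ind Cu (Fin.snoc q 1 : Pd (n + 1)) = ind Cu (Fin.snoc q 2 : Pd (n + 1)))
    (hAB : ∀ q : Pd n, (Fin.snoc q 0 : Pd (n + 1)) ∈ Au → (Fin.snoc q 0 : Pd (n + 1)) ∈ Bu)
    (hAC : ∀ q : Pd n, (Fin.snoc q 0 : Pd (n + 1)) ∈ Au → (Fin.snoc q 0 : Pd (n + 1)) ∈ Cu) :
    4 * sStarD (univ.filter fun q : Pd n => (Fin.snoc q 2 : Pd (n + 1)) ∈ Au) (univ.filter fun q : Pd n => (Fin.snoc q 2 : Pd (n + 1)) ∈ Bu) (univ.filter fun q : Pd n => (Fin.snoc q 2 : Pd (n + 1)) ∈ Cu) + 2 * sStarD (univ.filter fun q : Pd n => (Fin.snoc q 0 : Pd (n + 1)) ∈ Au) (univ.filter fun q : Pd n => (Fin.snoc q 2 : Pd (n + 1)) ∈ Bu) (univ.filter fun q : Pd n => (Fin.snoc q 2 : Pd (n + 1)) ∈ Cu) ≤ sStarD Au Bu Cu :=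
  four_mul_sStarD_top_add_two_mul_le_of_upperStep_wface Au Bu Cu hA hB hC hAu hBu hCu (fun q h _ _ => hAB q h) (fun q h _ _ => hAC q h)

/-- **COMB-M⁺ ON THE MEET-BOTTOM FACE** (every `n`): `2·sStarD τ ≤ sStarD υ` when `A⁰ ⊆ B⁰ ∩ C⁰`, given the two `n`-dimensional functionals `≥ 0`. [this work] -/
theorem two_mul_sStarD_top_le_of_upperStep_meetBottom (Au Bu Cu : Finset (Pd (n + 1)))
    (hA : IsUpperSet (Au : Set (Pd (n + 1)))) (hB : IsUpperSet (Bu : Set (Pd (n + 1)))) (hC : IsUpperSet (Cu : Set (Pd (n + 1))))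
    (hAu : ∀ q : Pd n, ind Au (Fin.snoc q 1 : Pd (n + 1)) = ind Au (Fin.snoc q 2 : Pd (n + 1)))
    (hBu : ∀ q : Pd n, ind Bu (Fin.snoc q 1 : Pd (n + 1)) = ind Bu (Fin.snoc q 2 : Pd (n + 1)))
    (hCu : ∀ q : Pd n, ind Cu (Fin.snoc q 1 : Pd (n + 1)) = ind Cu (Fin.snoc q 2 : Pd (n + 1)))
    (hAB : ∀ q : Pd n, (Fin.snoc q 0 : Pd (n + 1)) ∈ Au → (Fin.snoc q 0 : Pd (n + 1)) ∈ Bu)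
    (hAC : ∀ q : Pd n, (Fin.snoc q 0 : Pd (n + 1)) ∈ Au → (Fin.snoc q 0 : Pd (n + 1)) ∈ Cu)
    (htop : 0 ≤ sStarD (univ.filter fun q : Pd n => (Fin.snoc q 2 : Pd (n + 1)) ∈ Au) (univ.filter fun q : Pd n => (Fin.snoc q 2 : Pd (n + 1)) ∈ Bu) (univ.filter fun q : Pd n => (Fin.snoc q 2 : Pd (n + 1)) ∈ Cu))
    (hlow : 0 ≤ sStarD (univ.filter fun q : Pd n => (Fin.snoc q 0 : Pd (n + 1)) ∈ Au) (univ.filter fun q : Pd n => (Fin.snoc q 2 : Pd (n + 1)) ∈ Bu) (univ.filter fun q : Pd n => (Fin.snoc q 2 : Pd (n + 1)) ∈ Cu)) :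
    2 * sStarD (univ.filter fun q : Pd n => (Fin.snoc q 2 : Pd (n + 1)) ∈ Au) (univ.filter fun q : Pd n => (Fin.snoc q 2 : Pd (n + 1)) ∈ Bu) (univ.filter fun q : Pd n => (Fin.snoc q 2 : Pd (n + 1)) ∈ Cu) ≤ sStarD Au Bu Cu := by
  have h := four_mul_sStarD_top_add_two_mul_le_of_upperStep_meetBottom Au Bu Cu hA hB hC hAu hBu hCu hAB hAC
  linarith

end Summit.CriticalPhenomena.PercolationContinuityZ3.Theorems.SahiGridPattern
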